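import Summits.Schanuel.Schanuel.Theorems.DiophantineDichotomyApproximationPropertyDefs

/-!
# Stub-ideation k = 3 (FAMILY 3 — probe the extremes) for stub `CycleAPIAt3 : CycleAPIAt 3`
(crux stmt-Schanuel-6117 `ApproximationProperty`, line `orbit-interpolation-determinant`)

Helper-lemma SIGNATURES only (each `sorry`), elaboration sanity for `STUB-IDEAS-CycleAPIAt3-3.md`.
Planner `planner-sidea-stmt-Schanuel-6117-CycleAPIAt3-3-0`, 2026-08-16. Nothing here is registered.
-/

set_option linter.dupNamespace false

noncomputable section

attribute [local instance] MvPolynomial.gradedAlgebra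

namespace Summit.Schanuel.Schanuel.Cruxes.ApproximationProperty.OrbitInterpolationDeterminant
namespace StubIdeasCycleAPIAt3K3

open Literature.NumberTheory.Transcendental.Nesterenko MvPolynomial
open scoped BigOperators

/-! ## L1 — the clause is monotone in the level (used to move certificates at level `3ν`,
`deg − 1`, … up to `⌊cΔ⌋`). One cycle: `H_𝔭` non-decreasing (linear nzd) and `≤ ideg`. -/
theorem interp_mono_level : ∀ (m : ℕ) (𝔭 : Ideal (Rx m)) (ν ν' : ℕ), 𝔭.IsPrime →
    𝔭.IsHomogeneous (homogeneousSubmodule (Fin (m + 1)) ℚ) → IsUnmixedOfRank 𝔭 1 → ν ≤ ν' →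
    Module.finrank ℚ ↥(homogeneousSubmodule (Fin (m + 1)) ℚ ν) =
      Module.finrank ℚ ↥(homogeneousSubmodule (Fin (m + 1)) ℚ ν ⊓ 𝔭.restrictScalars ℚ) +
        ideg 𝔭 1 →
    Module.finrank ℚ ↥(homogeneousSubmodule (Fin (m + 1)) ℚ ν') =
      Module.finrank ℚ ↥(homogeneousSubmodule (Fin (m + 1)) ℚ ν' ⊓ 𝔭.restrictScalars ℚ) +
        ideg 𝔭 1 := by
  sorry

/-! ## L2 — EXTREMAL DICHOTOMY (minimal counterexample to the clause ⇒ an enveloping ℚ-curve).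
For an orbit `𝔮` (rank-1 homogeneous prime of `ℚ[x₀..x₃]`) and a level `ν`: either some prime CURVE
`𝔶` swallows every degree-`ν` form of `𝔮` ("`𝔮` is `ν`-enveloped by `V(𝔶)`"), or the zeros of `𝔮`
lie on a complete intersection of type `(a, ν, ν)`, `a ≤ ν` (prime factor of one form + two
vector-space prime avoidances inside `(𝔮)_ν`, Macaulay `SpaceCIMacaulay`) and the registered
`elim_ciSpace` certifies the clause from level `3ν` on. -/
theorem interp_or_enveloped : ∀ (𝔮 : Ideal (Rx 3)) (ν : ℕ), 1 ≤ ν → 𝔮.IsPrime →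
    𝔮.IsHomogeneous (homogeneousSubmodule (Fin (3 + 1)) ℚ) → IsUnmixedOfRank 𝔮 1 →
    (∃ 𝔶 : Ideal (Rx 3), 𝔶.IsPrime ∧ ringKrullDim (Rx 3 ⧸ 𝔶) = (2 : ℕ) ∧
        ∀ F ∈ 𝔮, F.IsHomogeneous ν → F ∈ 𝔶) ∨
    ∀ s : ℕ, 3 * ν ≤ s →
      Module.finrank ℚ ↥(homogeneousSubmodule (Fin (3 + 1)) ℚ s) =
        Module.finrank ℚ ↥(homogeneousSubmodule (Fin (3 + 1)) ℚ s ⊓ 𝔮.restrictScalars ℚ) +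
          ideg 𝔮 1 := by
  sorry

/-! ## L3 — applied form at the level of the stage-2 curve: if the small prime curve `𝔭` is NOT
`ν`-enveloped by another curve, EVERY orbit of the third cut `V(𝔭) ∩ V(P)` (`deg P ≤ ν`, `P ∉ 𝔭`)
satisfies the clause from level `3ν` — whatever `P` the box principle returns. (From L2: an envelope
`𝔶` of `𝔮 ⊇ 𝔭 + (P)` contains `(𝔭)_ν`, so `𝔶 = 𝔭`, but then `x_j^{ν-b} P ∈ 𝔭`, absurd.) -/
theorem interp_of_not_enveloped : ∀ (𝔭 𝔮 : Ideal (Rx 3)) (P : Rx 3) (ν b : ℕ), 1 ≤ ν → b ≤ ν →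
    𝔭.IsPrime → 𝔭.IsHomogeneous (homogeneousSubmodule (Fin (3 + 1)) ℚ) →
    ringKrullDim (Rx 3 ⧸ 𝔭) = (2 : ℕ) → P.IsHomogeneous b → P ∉ 𝔭 →
    (∀ 𝔶 : Ideal (Rx 3), 𝔶.IsPrime → ringKrullDim (Rx 3 ⧸ 𝔶) = (2 : ℕ) →
      (∀ F ∈ 𝔭, F.IsHomogeneous ν → F ∈ 𝔶) → 𝔶 = 𝔭) →
    𝔮.IsPrime → 𝔮.IsHomogeneous (homogeneousSubmodule (Fin (3 + 1)) ℚ) → IsUnmixedOfRank 𝔮 1 →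
    𝔭 ≤ 𝔮 → P ∈ 𝔮 →
    ∀ s : ℕ, 3 * ν ≤ s →
      Module.finrank ℚ ↥(homogeneousSubmodule (Fin (3 + 1)) ℚ s) =
        Module.finrank ℚ ↥(homogeneousSubmodule (Fin (3 + 1)) ℚ s ⊓ 𝔮.restrictScalars ℚ) +
          ideg 𝔮 1 := by
  sorry

/-! ## L4 — what the extremal configuration FORCES (quantitative): an envelope of the small curve
`V(𝔭) ⊂ V(Q) ∩ V(P)` at level `ν` is a satellite component of the c.i. of LOW degree,
`(ν − a − b)·deg 𝔶 ≤ (a + b + 1)·deg 𝔭` (slope `≥ deg 𝔭 + deg 𝔶` of `H(𝔭 ∩ 𝔶; ·)` from `a + b`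
on, = the registered `curveHilbert_lowerBound` mechanism for the unmixed ideal `𝔭 ∩ 𝔶`, against
`H(𝔭 ∩ 𝔶; ν) = H(𝔭; ν) ≤ deg 𝔭 · (ν + 1)`, `Nesterenko.hilbert_le_of_isPrime`). -/
theorem envelope_degree_le : ∀ (Q P : Rx 3) (a b ν : ℕ) (𝔭 𝔶 : Ideal (Rx 3)), Q ≠ 0 →
    Q.IsHomogeneous a → P.IsHomogeneous b → 1 ≤ a → 1 ≤ b → (Ideal.span {Q}).IsPrime →
    P ∉ Ideal.span {Q} → 𝔭.IsPrime → 𝔭.IsHomogeneous (homogeneousSubmodule (Fin (3 + 1)) ℚ) →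
    ringKrullDim (Rx 3 ⧸ 𝔭) = (2 : ℕ) → 𝔶.IsPrime →
    𝔶.IsHomogeneous (homogeneousSubmodule (Fin (3 + 1)) ℚ) → ringKrullDim (Rx 3 ⧸ 𝔶) = (2 : ℕ) →
    Q ∈ 𝔭 → P ∈ 𝔭 → 𝔶 ≠ 𝔭 → (∀ F ∈ 𝔭, F.IsHomogeneous ν → F ∈ 𝔶) → a + b ≤ ν →
    (ν - a - b) * ideg 𝔶 2 ≤ (a + b + 1) * ideg 𝔭 2 := by
  sorry

/-! ## L5 — COLLINEAR extremal case: a qualifying orbit on a rational line forces `ω̄` onto the line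
(the LEVER `OrbitClusterBound` at `t = 1` on the line + dictionary (D) + min over cluster sizes):
`log(1/dist(ω̄, ℓ)) ≥ γ · min(S, S² / (D (h + D (log(2 + |A| + |B|) + log(D + 1)))))`. -/
theorem collinear_line_proximity : ∀ ω : Fin 3 → ℂ, ∃ γ : ℝ, 0 < γ ∧ ∃ C : ℝ, 0 < C ∧
    ∀ (𝔮 : Ideal (Rx 3)) (A B : Fin (3 + 1) → ℤ) (S : ℝ), 𝔮.IsPrime →
      𝔮.IsHomogeneous (homogeneousSubmodule (Fin (3 + 1)) ℚ) → IsUnmixedOfRank 𝔮 1 →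
      LinearIndependent ℚ ![(fun j => (A j : ℚ)), (fun j => (B j : ℚ))] →
      (∀ β ∈ projZeros 𝔮, ∃ u v : ℂ, β = fun j => u * (A j : ℂ) + v * (B j : ℂ)) →
      iabs 𝔮 1 (Fin.cons 1 ω) ≤ Real.exp (-S) →
      C * ideg 𝔮 1 * (1 + Real.log (2 + ‖(fun j => (A j : ℝ))‖ + ‖(fun j => (B j : ℝ))‖)) ≤ S →
      ∃ u v : ℂ, (u ≠ 0 ∨ v ≠ 0) ∧
        projDist (Fin.cons 1 ω) (fun j => u * (A j : ℂ) + v * (B j : ℂ)) ≤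
          Real.exp (-(γ * min S (S ^ 2 / (ideg 𝔮 1 * (iheight 𝔮 1 + ideg 𝔮 1 *
            (Real.log (2 + ‖(fun j => (A j : ℝ))‖ + ‖(fun j => (B j : ℝ))‖) +
              Real.log ((ideg 𝔮 1 : ℝ) + 1))))))) := by
  sorry

/-! ## L6 — perturbation of the PROVED neighbour `t = 1`: uniform (|ξ| ≤ 2), weighted, PRIME-output
binary Dirichlet (Bugeaud Lemma 8.1 `exists_int_poly_small_value` + homogenisation as in the landed
`stub_cycleAPI_one` + weighted pigeonhole `exists_component_le_exp` over the prime factors). -/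
theorem binaryDirichlet_weighted_unif : ∃ C : ℝ, 0 < C ∧ ∀ (ξ : ℂ) (D : ℕ) (H wa wb : ℝ),
    ‖ξ‖ ≤ 2 → 50 ≤ D → C ≤ H → 0 ≤ wa → 0 ≤ wb → 0 < wa + wb →
    ∃ 𝔯 : Ideal (Rx 1), 𝔯.IsPrime ∧ 𝔯.IsHomogeneous (homogeneousSubmodule (Fin (1 + 1)) ℚ) ∧
      IsUnmixedOfRank 𝔯 1 ∧ 1 ≤ ideg 𝔯 1 ∧ ideg 𝔯 1 ≤ D ∧ iheight 𝔯 1 ≤ H + C * D ∧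
      iabs 𝔯 1 (Fin.cons 1 fun _ => ξ) ≤
        Real.exp (-(((2 : ℝ) / 5 * D * H - C * D) / (wa * (H + C * D) + wb * D)) *
          (wa * iheight 𝔯 1 + wb * ideg 𝔯 1)) := by
  sorry

/-! ## L7a — dictionary (D′), the UPPER twin of the landed `exp_mul_prod_projDist_le_iabs`:
`|𝔭(ω̄)| ≤ e^{c deg 𝔭} ∏_σ dist(ω̄, σ b)` (Gelfond's lower bound for `|F|`, trivial upper bound for
`|ϰ(F)|`). -/
theorem iabs_le_exp_mul_prod_projDist : ∀ (m : ℕ) (𝔭 : Ideal (Rx m)), 𝔭.IsPrime →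
    𝔭.IsHomogeneous (homogeneousSubmodule (Fin (m + 1)) ℚ) → IsUnmixedOfRank 𝔭 1 →
    ∀ (b' : Fin (m + 1) → ℂ), b' ∈ projZeros 𝔭 → ∀ (j : Fin (m + 1)), b' j = 1 →
    ∀ [NumberField ↥(IntermediateField.adjoin ℚ (Set.range b'))]
      (b : Fin (m + 1) → ↥(IntermediateField.adjoin ℚ (Set.range b'))), (∀ k, (b k : ℂ) = b' k) →
    ∀ ω : Fin (m + 1) → ℂ, ω ≠ 0 →
      iabs 𝔭 1 ω ≤ Real.exp ((2 * (m : ℝ) ^ 2 + 2) * ideg 𝔭 1) *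
        ∏ σ : ↥(IntermediateField.adjoin ℚ (Set.range b')) →+* ℂ, projDist ω (fun k => σ (b k)) := by
  sorry

/-! ## L7b — dictionary (C′), the converse of the landed `logHeight_le`:
`h(𝔭) ≤ h_K(b) + c deg 𝔭` (Chow form `= q ∏_σ ⟨σ b, u⟩`, Gauss + Mahler). -/
theorem iheight_le_logHeight : ∀ (m : ℕ) (𝔭 : Ideal (Rx m)), 𝔭.IsPrime →
    𝔭.IsHomogeneous (homogeneousSubmodule (Fin (m + 1)) ℚ) → IsUnmixedOfRank 𝔭 1 →
    ∀ (b' : Fin (m + 1) → ℂ), b' ∈ projZeros 𝔭 → ∀ (j : Fin (m + 1)), b' j = 1 →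
    ∀ [NumberField ↥(IntermediateField.adjoin ℚ (Set.range b'))]
      (b : Fin (m + 1) → ↥(IntermediateField.adjoin ℚ (Set.range b'))), (∀ k, (b k : ℂ) = b' k) →
    iheight 𝔭 1 ≤ Height.logHeight b + (2 * (m : ℝ) + 2) * ideg 𝔭 1 := by
  sorry

/-! ## L7 — TRANSPORT `ℙ¹ → rational line ℓ = ⟨A, B⟩ ⊂ ℙ³` of a prime 0-cycle (comap along
`x_j ↦ A_j y₀ + B_j y₁`; degree by dictionary (B), height by (C)+(C′), value by (D)+(D′) and the
min-lemma `∑ min(L, a_σ) ≥ min(L, ∑ a_σ)`): ONE factor of `dist(ω̄, image of ξ)` caps the value. -/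
theorem line_transport : ∃ C₀ : ℝ, 0 < C₀ ∧ ∀ (A B : Fin (3 + 1) → ℤ),
    LinearIndependent ℚ ![(fun j => (A j : ℚ)), (fun j => (B j : ℚ))] →
    ∀ 𝔯 : Ideal (Rx 1), 𝔯.IsPrime → 𝔯.IsHomogeneous (homogeneousSubmodule (Fin (1 + 1)) ℚ) →
      IsUnmixedOfRank 𝔯 1 →
      ∃ 𝔮 : Ideal (Rx 3), 𝔮.IsPrime ∧ 𝔮.IsHomogeneous (homogeneousSubmodule (Fin (3 + 1)) ℚ) ∧
        IsUnmixedOfRank 𝔮 1 ∧ ideg 𝔮 1 = ideg 𝔯 1 ∧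
        iheight 𝔮 1 ≤ iheight 𝔯 1 +
          C₀ * (1 + Real.log (2 + ‖(fun j => (A j : ℝ))‖ + ‖(fun j => (B j : ℝ))‖)) * ideg 𝔯 1 ∧
        (∀ β ∈ projZeros 𝔮, ∃ u v : ℂ, β = fun j => u * (A j : ℂ) + v * (B j : ℂ)) ∧
        ∀ (ω : Fin (3 + 1) → ℂ) (ξ : Fin (1 + 1) → ℂ), ω ≠ 0 → ξ ≠ 0 →
          iabs 𝔮 1 ω ≤
            Real.exp (C₀ * (1 + Real.log (2 + ‖(fun j => (A j : ℝ))‖ + ‖(fun j => (B j : ℝ))‖)) *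
                ideg 𝔯 1) *
              max (iabs 𝔯 1 ξ) (projDist ω (fun j => ξ 0 * (A j : ℂ) + ξ 1 * (B j : ℂ))) := by
  sorry

/-! ## L8 — restart bookkeeping (pure real arithmetic, shape of `stub_cycleAPI_two_lemmas`):
Dirichlet degree cap `D₀ ∈ [5Δ/c, 56Δ/c]`, log-height `H = 56(c₁(1+Δ/c) + B₀)`,
`B₀ = c₁(h(ℓ)+1)(1+Δ/c) + Y/c`, weights `(Δ/c, B₀)` in L6, transport losses `c₁` per point (L7):
the transported `t = 1` output meets the `CycleAPIAt 3` accuracy with the OUTPUT constant `c` as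
soon as `log(1/dist(ω̄, ℓ)) = L ≥ (224 c₁ Δ / c²)(Δ h(ℓ) + Y + 2Δ)` — which L5 delivers (threshold
`γ Δ (Δ h(ℓ) + Y) / c_a²` in the CONSTRUCTION constant `c_a`) once `c² ≥ 224 c₁ c_a² / γ`, outside the
log-window of the plan. Checked by hand (ratio ≥ 1 from `D₀ ≥ 5Δ/c`; cap from `D₀ ≤ 56Δ/c`). -/
theorem restart_arith : ∀ (c c₁ Δ Y hℓ L H D₀ hr Dr hq Sr : ℝ), 1 ≤ c₁ → c₁ ≤ c → c ≤ Δ →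
    Δ ≤ Y → 0 ≤ hℓ → 5 * Δ / c ≤ D₀ → D₀ ≤ 56 * Δ / c →
    H = 56 * (c₁ * (1 + Δ / c) + (c₁ * (hℓ + 1) * (1 + Δ / c) + Y / c)) →
    0 ≤ Dr → Dr ≤ D₀ → 0 ≤ hr → hr ≤ H + c₁ * D₀ →
    (2 / 5 * D₀ * H - c₁ * D₀) /
          (Δ / c * (H + c₁ * D₀) + (c₁ * (hℓ + 1) * (1 + Δ / c) + Y / c) * D₀) *
        (Δ / c * hr + (c₁ * (hℓ + 1) * (1 + Δ / c) + Y / c) * Dr) ≤ Sr →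
    hq ≤ hr + c₁ * Dr * (hℓ + 1) →
    224 * c₁ * Δ / c ^ 2 * (Δ * hℓ + Y + 2 * Δ) ≤ L →
    (Δ * hq + Y * Dr) / c + c₁ * Dr * (hℓ + 1) ≤ min Sr L := by
  sorry

end StubIdeasCycleAPIAt3K3
end Summit.Schanuel.Schanuel.Cruxes.ApproximationProperty.OrbitInterpolationDeterminant

end
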